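import Mathlib
import Summits.Ventures.PercRepro2.Defs
import Summits.Ventures.PercRepro2.Harris
import Summits.Ventures.PercRepro2.FourFunctions
import Summits.Ventures.PercRepro2.Graph
import Summits.Ventures.PercRepro2.Events
import Summits.Ventures.PercRepro2.Bernstein
import Summits.Ventures.PercRepro2.MM0Sector

/-!
# Row 2′MM0 (MM0⁻): the three-configuration Bernstein expansion and the pinned (weight-free)
sufficient condition (blind cell PercRepro2, night-1 g2; `proofs/NIGHT1-MM0.md` §7)

The cleared (MM0⁻) form `F = a²·YZ_E − a·Y_R·Z_E − a·Z_R·Y_E + Y_R·Z_R·g` (`MM0Sector.mm0minusForm`)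
is a CUBIC in the masses, hence a sum over ordered TRIPLES of configurations:

  `F = ∑_{x, y, z} w(x) w(y) w(z) · K(x, y, z)`,
  `K(x, y, z) = 1_R(y) 1_R(z) · [1_{Y∩Zev∩gate}(x) − 1_Y(y) 1_{Zev∩gate}(x) − 1_{Z₀}(z) 1_{Y∩gate}(x) + 1_Y(y) 1_{Z₀}(z) 1_{gate}(x)]`
  `(= 1_gate(x) 1_R(y) 1_R(z) (y(x) − y(y)) (Z(x) − Z₀(z)))`

(`mm0minusForm_eq_sum_tripleKernel`). Grouping the triples by their ORDER STATISTICS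
`(x ⊓ y ⊓ z, med(x, y, z), x ⊔ y ⊔ z)` — the edges open in all three, in at least two, in at least one
copies — and using the log-modularity of the product weight twice
(`weight_mul_weight_mul_weight`: `w(x) w(y) w(z) = w(lo) w(mid) w(hi)`), `F` becomes the weighted
sum of the three-copy PATTERN COEFFICIENTS `c(lo, mid, hi) = ∑_{(x,y,z) with these order statistics} K(x,y,z)`
(`mm0minusForm_eq_sum_patternCoeff3`): the three-configuration analogue of mine-1's two-copy
expansion (`Bernstein.lean`, R13-STATEMENT Lemma 2.1) and of p1's `CrossBase` (`TwoCopyBHK.lean`).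

`PinnedMM0` — every pattern coefficient is `≤ 0` — is a WEIGHT-FREE counting statement (for each
type assignment «open in exactly k_e of the three copies», the signed count of 3-colourings of the free
edges is `≤ 0`; in the marker pattern `(y(x), Z(x) | y(y), Z₀(z))` it reads
`N(1,1|0,0) + N(0,0|1,1) ≤ N(1,0|0,1) + N(0,1|1,0)`); **`mm0minus_of_pinned`**: it implies (MM0⁻) for
every admissible weight vector. Exact census of `PinnedMM0` (night-1 g2): 960 random instances with
`n = 6, 7`, `m = 5..8` — all `4^m` coefficients, 34,575,360 in total — 0 positive; the same machinery
applied to the FALSE sector-1 form gives 63 positive coefficients on `c6_00023` (control). One seat;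
not a theorem.
-/

namespace Summit.Ventures.PercRepro2
namespace MM0Pinned

open MM0Sector

variable {V : Type*} {E : Type*} [Fintype E] [DecidableEq E] [Fintype V] [DecidableEq V]
  {R : Type*} [CommRing R]

/-! ## Three-copy sums and the log-modularity of the weight -/

section Triples

variable (p : E → R)

open Classical in
/-- A product of three probabilities as a sum over ordered triples of configurations. -/
lemma prob_mul_prob_mul_prob (A B C : Set (Config E)) :
    prob p A * prob p B * prob p C =
      ∑ x : Config E, ∑ y : Config E, ∑ z : Config E, weight p x * weight p y * weight p z *
        ((if x ∈ A then 1 else 0) * (if y ∈ B then 1 else 0) * (if z ∈ C then 1 else 0)) := by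
  rw [prob_eq_sum_weight_mul, prob_eq_sum_weight_mul, prob_eq_sum_weight_mul, Finset.sum_mul_sum,
    Finset.sum_mul_sum]
  refine Finset.sum_congr rfl fun x _ => ?_
  simp only [Finset.sum_mul]
  rw [Finset.sum_comm]
  refine Finset.sum_congr rfl fun y _ => Finset.sum_congr rfl fun z _ => ?_
  ring

/-- The "median" of three configurations: the edges open in at least two of them. -/
def med (x y z : Config E) : Config E := (x ⊓ y) ⊔ ((x ⊔ y) ⊓ z)

/-- The "bottom" of three configurations as produced by the two-step log-modularity: equal to
`x ⊓ y ⊓ z` (the edges open in all three). -/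
def lo (x y z : Config E) : Config E := (x ⊓ y) ⊓ ((x ⊔ y) ⊓ z)

omit [Fintype E] [DecidableEq E] in
/-- `lo x y z = x ⊓ y ⊓ z`. -/
lemma lo_eq (x y z : Config E) : lo x y z = x ⊓ y ⊓ z := by
  unfold lo
  funext e
  simp only [Pi.inf_apply, Pi.sup_apply]
  cases x e <;> cases y e <;> cases z e <;> rfl

omit [DecidableEq E] in
/-- **Log-modularity for three configurations**: `w(x) w(y) w(z) = w(lo) w(med) w(x ⊔ y ⊔ z)`. -/
lemma weight_mul_weight_mul_weight (x y z : Config E) :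
    weight p x * weight p y * weight p z =
      weight p (lo x y z) * weight p (med x y z) * weight p (x ⊔ y ⊔ z) := by
  rw [← weight_inf_mul_weight_sup p x y, mul_assoc, ← weight_inf_mul_weight_sup p (x ⊔ y) z,
    ← mul_assoc, ← weight_inf_mul_weight_sup p (x ⊓ y) ((x ⊔ y) ⊓ z)]
  rfl

end Triples

/-! ## The kernel and the pattern coefficients -/

section Kernel

variable (ends : E → Sym2 V) (s t b u w v : V)

open Classical in
/-- The three-copy kernel of (MM0⁻): `x` carries the gate and the measured markers, `y` the
`y`-reference, `z` the `Z₀`-reference. -/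
noncomputable def tripleKernel (x y z : Config E) : R :=
  (if y ∈ (connEvent ends s t)ᶜ then 1 else 0) * (if z ∈ (connEvent ends s t)ᶜ then 1 else 0) *
    ((if x ∈ connEvent ends s b ∩ Zev ends t u w v ∩ gate ends s t u w then 1 else 0)
      - (if y ∈ connEvent ends s b then 1 else 0) *
          (if x ∈ Zev ends t u w v ∩ gate ends s t u w then 1 else 0)
      - (if z ∈ connEvent ends t v then 1 else 0) *
          (if x ∈ connEvent ends s b ∩ gate ends s t u w then 1 else 0)
      + (if y ∈ connEvent ends s b then 1 else 0) * (if z ∈ connEvent ends t v then 1 else 0) *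
          (if x ∈ gate ends s t u w then 1 else 0))

open Classical in
/-- The three-copy pattern coefficient at the pattern `(lo, mid, hi)`: the sum of the kernel over
the ordered triples with these order statistics. -/
noncomputable def patternCoeff3 (pat : Config E × Config E × Config E) : R :=
  ∑ xyz : Config E × Config E × Config E,
    if (lo xyz.1 xyz.2.1 xyz.2.2, med xyz.1 xyz.2.1 xyz.2.2, xyz.1 ⊔ xyz.2.1 ⊔ xyz.2.2) = pat then
      tripleKernel ends s t b u w v xyz.1 xyz.2.1 xyz.2.2 else 0

end Kernel

/-! ## The expansion -/

section Expansion

variable (p : E → R) (ends : E → Sym2 V) (s t b u w v : V)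

omit [Fintype V] [DecidableEq V] in
open Classical in
/-- **(MM0⁻) as a triple sum**: `mm0minusForm = ∑_{x,y,z} w(x) w(y) w(z) K(x,y,z)`. -/
theorem mm0minusForm_eq_sum_tripleKernel :
    mm0minusForm p ends s t b u w v =
      ∑ x : Config E, ∑ y : Config E, ∑ z : Config E,
        weight p x * weight p y * weight p z * tripleKernel ends s t b u w v x y z := by
  have h1 : prob p (connEvent ends s t)ᶜ ^ 2 *
      prob p (connEvent ends s b ∩ Zev ends t u w v ∩ gate ends s t u w) =
      prob p (connEvent ends s b ∩ Zev ends t u w v ∩ gate ends s t u w) *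
        prob p (connEvent ends s t)ᶜ * prob p (connEvent ends s t)ᶜ := by ring
  have h2 : prob p (connEvent ends s t)ᶜ * prob p (connEvent ends s b ∩ (connEvent ends s t)ᶜ) *
      prob p (Zev ends t u w v ∩ gate ends s t u w) =
      prob p (Zev ends t u w v ∩ gate ends s t u w) *
        prob p (connEvent ends s b ∩ (connEvent ends s t)ᶜ) * prob p (connEvent ends s t)ᶜ := by ring
  have h3 : prob p (connEvent ends s t)ᶜ * prob p (connEvent ends t v ∩ (connEvent ends s t)ᶜ) *
      prob p (connEvent ends s b ∩ gate ends s t u w) =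
      prob p (connEvent ends s b ∩ gate ends s t u w) * prob p (connEvent ends s t)ᶜ *
        prob p (connEvent ends t v ∩ (connEvent ends s t)ᶜ) := by ring
  have h4 : prob p (connEvent ends s b ∩ (connEvent ends s t)ᶜ) *
      prob p (connEvent ends t v ∩ (connEvent ends s t)ᶜ) * prob p (gate ends s t u w) =
      prob p (gate ends s t u w) * prob p (connEvent ends s b ∩ (connEvent ends s t)ᶜ) *
        prob p (connEvent ends t v ∩ (connEvent ends s t)ᶜ) := by ring
  unfold mm0minusForm
  rw [h1, h2, h3, h4, prob_mul_prob_mul_prob, prob_mul_prob_mul_prob, prob_mul_prob_mul_prob,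
    prob_mul_prob_mul_prob, ← Finset.sum_sub_distrib, ← Finset.sum_sub_distrib,
    ← Finset.sum_add_distrib]
  refine Finset.sum_congr rfl fun x _ => ?_
  rw [← Finset.sum_sub_distrib, ← Finset.sum_sub_distrib, ← Finset.sum_add_distrib]
  refine Finset.sum_congr rfl fun y _ => ?_
  rw [← Finset.sum_sub_distrib, ← Finset.sum_sub_distrib, ← Finset.sum_add_distrib]
  refine Finset.sum_congr rfl fun z _ => ?_
  unfold tripleKernel
  by_cases hxY : x ∈ connEvent ends s b <;> by_cases hxZ : x ∈ Zev ends t u w v <;>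
    by_cases hxG : x ∈ gate ends s t u w <;> by_cases hyY : y ∈ connEvent ends s b <;>
    by_cases hyR : y ∈ (connEvent ends s t)ᶜ <;> by_cases hzZ : z ∈ connEvent ends t v <;>
    by_cases hzR : z ∈ (connEvent ends s t)ᶜ <;>
    simp [Set.mem_inter_iff, hxY, hxZ, hxG, hyY, hyR, hzZ, hzR]

omit [Fintype V] [DecidableEq V] in
open Classical in
/-- **Three-configuration Bernstein expansion of (MM0⁻)**: the weighted sum of the pattern
coefficients, with weight `w(lo) w(mid) w(hi)` on the pattern. -/
theorem mm0minusForm_eq_sum_patternCoeff3 :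
    mm0minusForm p ends s t b u w v =
      ∑ pat : Config E × Config E × Config E,
        weight p pat.1 * weight p pat.2.1 * weight p pat.2.2 *
          patternCoeff3 ends s t b u w v pat := by
  have hT : mm0minusForm p ends s t b u w v =
      ∑ xyz : Config E × Config E × Config E,
        weight p xyz.1 * weight p xyz.2.1 * weight p xyz.2.2 *
          tripleKernel ends s t b u w v xyz.1 xyz.2.1 xyz.2.2 := by
    rw [mm0minusForm_eq_sum_tripleKernel, Fintype.sum_prod_type]
    refine Finset.sum_congr rfl fun x _ => ?_
    rw [Fintype.sum_prod_type]
  rw [hT]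
  unfold patternCoeff3
  simp only [Finset.mul_sum]
  rw [Finset.sum_comm]
  refine Finset.sum_congr rfl fun xyz _ => ?_
  have key : ∀ pat : Config E × Config E × Config E,
      weight p pat.1 * weight p pat.2.1 * weight p pat.2.2 *
        (if (lo xyz.1 xyz.2.1 xyz.2.2, med xyz.1 xyz.2.1 xyz.2.2, xyz.1 ⊔ xyz.2.1 ⊔ xyz.2.2) = pat
          then tripleKernel ends s t b u w v xyz.1 xyz.2.1 xyz.2.2 else 0)
      = if (lo xyz.1 xyz.2.1 xyz.2.2, med xyz.1 xyz.2.1 xyz.2.2, xyz.1 ⊔ xyz.2.1 ⊔ xyz.2.2) = pat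
          then weight p (lo xyz.1 xyz.2.1 xyz.2.2) * weight p (med xyz.1 xyz.2.1 xyz.2.2) *
            weight p (xyz.1 ⊔ xyz.2.1 ⊔ xyz.2.2) * tripleKernel ends s t b u w v xyz.1 xyz.2.1 xyz.2.2
          else 0 := by
    intro pat
    by_cases h : (lo xyz.1 xyz.2.1 xyz.2.2, med xyz.1 xyz.2.1 xyz.2.2, xyz.1 ⊔ xyz.2.1 ⊔ xyz.2.2) = pat
    · rw [if_pos h, if_pos h, ← h]
    · rw [if_neg h, if_neg h, mul_zero]
  simp only [key]
  rw [Finset.sum_ite_eq, if_pos (Finset.mem_univ _), weight_mul_weight_mul_weight]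

end Expansion

/-! ## The pinned statement implies (MM0⁻) for every weight vector -/

section Main

variable [LinearOrder R]

/-- **The pinned (weight-free) statement**: every three-copy pattern coefficient is nonpositive. -/
def PinnedMM0 (ends : E → Sym2 V) (s t b u w v : V) : Prop :=
  ∀ pat : Config E × Config E × Config E, patternCoeff3 (R := R) ends s t b u w v pat ≤ 0

variable [IsStrictOrderedRing R]

omit [Fintype V] [DecidableEq V] in
/-- **`PinnedMM0 → (MM0⁻)`**: if every three-copy pattern coefficient is nonpositive, then
`mm0minusForm ≤ 0` for every admissible weight vector. -/
theorem mm0minus_of_pinned {p : E → R} (hp : IsProbVec p) (ends : E → Sym2 V) (s t b u w v : V)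
    (hpin : PinnedMM0 (R := R) ends s t b u w v) : mm0minusForm p ends s t b u w v ≤ 0 := by
  rw [mm0minusForm_eq_sum_patternCoeff3]
  refine Finset.sum_nonpos fun pat _ => ?_
  exact mul_nonpos_of_nonneg_of_nonpos
    (mul_nonneg (mul_nonneg (weight_nonneg hp _) (weight_nonneg hp _)) (weight_nonneg hp _))
    (hpin pat)

end Main

end MM0Pinned
end Summit.Ventures.PercRepro2
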